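import Summits.ResolutionOfSingularities.ResolutionOfSingularities.Theorems.WeightedInvariantLocalWeightedDropNCTameBinomialRungClosed
import Summits.ResolutionOfSingularities.ResolutionOfSingularities.Theorems.WeightedInvariantLocalWeightedDropNCSmoothPower
import Summits.ResolutionOfSingularities.ResolutionOfSingularities.Theorems.WeightedInvariantLocalWeightedDropWeierstrassForm
import Summits.ResolutionOfSingularities.ResolutionOfSingularities.Theorems.WeightedInvariantLocalWeightedDropMonomialPhaseChart

/-!
# W4.3 `LocalWeightedDrop` — TOT rung R8: THE NC ENDGAME, PART 1 (graph positions and the curve blow-up step)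

[OURS · L1 W4.3 · engine crux `LocalWeightedDrop` stmt-ResolutionOfSingularities-8899 · residual stub `stub_spaceNCRankDrop` (v32) ·
TOT2-LINE v1 unit S-END (the `o = 1` endgame).  Strategist sketch res-L1-w43-strat-1 gen 6, `lean check` rc 0 · 0 sorries; offered for
verbatim adoption as TWO modules (PART 1 = this header … `end Phase2`; PART 2 = the rest, importing PART 1); closes no stub by name.
AI-produced, weaker than expert review; NOT a statement of the manuscript under review ([claim: Hironaka2017, status: under-review]).]

THE THEOREM (PART 2, every field, no characteristic hypothesis): `exists_winsIn_orderOne_mul : f.order = 1 → constantCoeff u ≠ 0 →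
∃ N, WinsIn (m := 2) GermIsNC N (u * f * ∏ l, X l ^ v l)` — an order-`1` germ in three variables times ANY monomial in the
coordinate letters (the flagged boundary, old and new components alike, any multiplicities) times a unit is brought to
normal-crossing support by finitely many legal moves of the NC count game (`…SpaceCountGame`), uniformly over the exceptional points;
corollary `exists_winsIn_orderOne_mul_prod` (the Finset form `f * ∏ l ∈ E, X l` = S-SET's `Decoration.total` at `o = 1`).  This
REPLACES the `ℕ³`-measure endgame of TOT2-LINE v1 §6 killed in CRITIQUE-TOT2-v1 §0 (Q3): the endgame needs no Lyapunov function.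

PART 1 = PHASE 2 of the proof.  A GRAPH POSITION is `graphPos U V h = (U · x^V) · (x_2 + h^L)` (`U` a unit, `V` any exponents,
`h` a PLANE series placed on the left block `x_0, x_1` by `rename (bL h102)`).  `winsIn_graphPos`: if `h = vh · x_0^{e_0} x_1^{e_1}`
(`vh` a plane unit) the mover wins within `e_0 + e_1` rounds — `e = 0`: the bracket is a unit, the position a unit monomial (NC);
`e_0 ≥ 1` (after the swap `x_0 ↔ x_1` if `e_0 = 0`, `rename_swap_graphPos`): blow up the CURVE `V(x_2, x_0)` (weights `(1, 0, 1)`,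
identity coordinates; `winsIn_graphPos_step`): at an exceptional point on the old axis (`c_2 = 0`) the successor is a graph position
with `(e_0 - 1, e_1)` (`TupleMonomialPhase.subst_chart_unitMonomial`, `slice_bracket`, `subst_chart_rename_bL`); off it (`c_2 ≠ 0`)
the bracket becomes a unit or — at the one tangential point — a smooth graph over the UNFLAGGED letter `x_2`
(`germIsNC_of_smooth_mul_unitMonomial`): NC either way (radical transport `germIsNC_of_dvd_pow` / `winsIn_of_dvd_pow_at`).
ALTERNATIVE PART 1 (res-D-pv-006 12:23:09Z): a graph position with monomial data is the unit binomial
`U·x^(V + 𝟙_2) + (U·vh^L)·x^(V + (e, 0))`, exponents differing by `1` in the `x_2`-letter (distinguishable in every field), so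
`winsIn_graphPos` is also one application of `winsIn_binomial (toricStep 2) (toricEnd 2)` (…NCTameBinomialEndGame) — but with the
bound `boxBudget 2 (max exponent)`, which depends on `V` (so Phase 1 would have to carry `ord η` in its potential, as R7 does); the
explicit curve blow-ups below win within `e_0 + e_1 ≤ ord h` rounds whatever `U, V`, which is why PART 2's potential is `ord h` alone.
TYPING NOTE: the right block `{x_2}` has size `rz + 1` with `rz := 0` a NAMED zero (`h102 : 1 + rz + 1 = 2`), so that the block
lemmas of `…NCBlocks` / `…NCTameBinomialRung` (over `hM : m₁ + m₂ + 1 = M`) unify without the numeral-offset pitfall of `1 + 0`.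
-/

noncomputable section

open Literature.AlgebraicGeometry.Resolution

set_option linter.dupNamespace false -- mandated namespace of this single-conjunct summit

namespace Summit.ResolutionOfSingularities.ResolutionOfSingularities.Theorems

namespace NCTransport

open MvPowerSeries TameFourTupleDrop

variable {k : Type} [Field k]

/-! ## Small algebra -/

/-- The size (minus one) of the right block `{x_2}`: a NAMED zero, so that the block lemmas of `…NCBlocks` (stated over
`hM : m₁ + m₂ + 1 = M`) unify against `h102` without the numeral-offset pitfall of `1 + 0`. -/
def rz : ℕ := 0

/-- The block proof for three variables: plane letters `x_0, x_1` = left block, `x_2` = right block. -/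
theorem h102 : 1 + rz + 1 = 2 := rfl

/-- The left block embedding fixes `1`. -/
theorem bL_one : bL h102 1 = 1 := Fin.ext rfl

/-- The right letter is `x_2`. -/
theorem bR_zero_eq_two : bR h102 0 = 2 := Fin.ext rfl

/-- `x_2` is not a left-block letter. -/
theorem two_not_mem_range_bL : (2 : Fin (2 + 1)) ∉ Set.range (bL h102) := by
  rintro ⟨i, hi⟩
  have h := congrArg Fin.val hi
  simp only [bL_val] at h
  have := i.isLt
  simp at h
  omega

/-- Adding `N` to one exponent of a monomial. -/
theorem prod_X_pow_add_single {n : ℕ} (j : Fin n) (v : Fin n → ℕ) (N : ℕ) :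
    (∏ i, (X i : MvPowerSeries (Fin n) k) ^ (v + Pi.single j N : Fin n → ℕ) i) = X j ^ N * ∏ i, X i ^ v i := by
  have h1 : (∏ i, (X i : MvPowerSeries (Fin n) k) ^ (Pi.single j N : Fin n → ℕ) i) = X j ^ N := by
    rw [Fintype.prod_eq_single j (fun i hi => by rw [Pi.single_eq_of_ne hi, pow_zero]), Pi.single_eq_same]
  rw [Finset.prod_congr rfl (fun i _ => show (X i : MvPowerSeries (Fin n) k) ^ (v + Pi.single j N : Fin n → ℕ) i =
      X i ^ v i * X i ^ (Pi.single j N : Fin n → ℕ) i by rw [Pi.add_apply, pow_add]), Finset.prod_mul_distrib, h1, mul_comm]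

/-- A unit monomial has normal-crossing support. -/
theorem germIsNC_unitMonomial {n : ℕ} {u : MvPowerSeries (Fin n) k} (hu : constantCoeff u ≠ 0) (v : Fin n → ℕ) :
    GermIsNC (u * ∏ i, X i ^ v i) :=
  germIsNC_unit_mul_prod_pow_coords (θ := X) (fun i => constantCoeff_X i) (isUnit_det_linMat_perm (Equiv.refl _)) hu v

/-- SATURATION SHIFT: if `s^N · Gb = s^A · G` with `s ∤ G`, then `Gb = s^j · G` for some `j`. -/
theorem exists_eq_X_pow_mul_of_eq {n N A : ℕ} {Gb G : MvPowerSeries (Fin (n + 1)) k} (h : X 0 ^ N * Gb = X 0 ^ A * G)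
    (hG : ¬ X 0 ∣ G) : ∃ j, Gb = X 0 ^ j * G := by
  have hX : (X 0 : MvPowerSeries (Fin (n + 1)) k) ≠ 0 := (MvPowerSeries.prime_X' k (0 : Fin (n + 1))).ne_zero
  rcases Nat.lt_or_ge A N with hlt | hle
  swap
  · refine ⟨A - N, mul_left_cancel₀ (pow_ne_zero N hX) ?_⟩
    rw [h, ← mul_assoc, ← pow_add, Nat.add_sub_cancel' hle]
  · exfalso
    apply hG
    have h2 : X 0 ^ A * (X 0 ^ (N - A) * Gb) = X 0 ^ A * G := by rw [← h, ← mul_assoc, ← pow_add, Nat.add_sub_cancel' hlt.le]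
    have h3 := mul_left_cancel₀ (pow_ne_zero A hX) h2
    rw [← h3]
    exact dvd_mul_of_dvd_left (dvd_pow_self _ (by omega)) _

/-- Radical transport at the clause: a successor dividing `s^j ·` a won (resp. NC) position. -/
theorem winsIn_of_eq_X_pow_mul {μ j : ℕ} {S T : MvPowerSeries (Fin (2 + 1)) k} (hT : T ≠ 0) (hS : S = X 0 ^ j * T)
    (hwin : WinsIn (m := 2) GermIsNC μ S) : WinsIn (m := 2) GermIsNC μ T :=
  winsIn_of_dvd_pow_at 0 (fun b d hd hnc hdvd => germIsNC_of_dvd_pow 0 b d hd hnc hdvd) μ T S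
    (by rw [hS]; exact mul_ne_zero (pow_ne_zero _ (MvPowerSeries.prime_X' k (0 : Fin (2 + 1))).ne_zero) hT) hwin
    ⟨X 0 ^ j, by rw [zero_add, pow_one, hS, mul_comm]⟩

/-! ## PHASE 2 — graph positions with monomial data: curve blow-ups -/

section Phase2

/-- THE GRAPH POSITION `(U · x^V) · (x_2 + h(x_0, x_1))` (`h` a plane series placed on the left block). -/
def graphPos (U : MvPowerSeries (Fin (2 + 1)) k) (V : Fin (2 + 1) → ℕ) (h : MvPowerSeries (Fin (1 + 1)) k) :
    MvPowerSeries (Fin (2 + 1)) k :=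
  (U * ∏ l, X l ^ V l) * (X 2 + rename (bL h102) h)

/-- `x_0 ^ t ·` commutes with the left placement. -/
theorem X_pow_mul_rename_bL (t : ℕ) (Z : MvPowerSeries (Fin (1 + 1)) k) :
    (X 0 : MvPowerSeries (Fin (2 + 1)) k) ^ t * rename (bL h102) Z = rename (bL h102) (X 0 ^ t * Z) := by
  rw [map_mul, map_pow, rename_X, bL_zero]

/-- A graph position with `h` a unit times the EMPTY monomial is a unit monomial: NC. -/
theorem germIsNC_graphPos_unit {U : MvPowerSeries (Fin (2 + 1)) k} (hU : constantCoeff U ≠ 0) (V : Fin (2 + 1) → ℕ)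
    {h : MvPowerSeries (Fin (1 + 1)) k} (hh : constantCoeff h ≠ 0) : GermIsNC (graphPos U V h) := by
  have heq : graphPos U V h = (U * (X 2 + rename (bL h102) h)) * ∏ l, X l ^ V l := by unfold graphPos; ring
  rw [heq]
  refine germIsNC_unitMonomial ?_ V
  rw [map_mul, map_add, constantCoeff_X, zero_add, constantCoeff_rename]
  exact mul_ne_zero hU hh

/-- THE CURVE BLOW-UP STEP.  From a graph position with `h = vh · x_0^{e_0} x_1^{e_1}`, `e_0 ≥ 1`, the blow-up of `V(x_2, x_0)`
(weights `(1, 0, 1)`, identity coordinates) leads, at every exceptional point, to an NC position or to a graph position with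
`(e_0 - 1, e_1)`. -/
theorem winsIn_graphPos_step (μ : ℕ)
    (ih : ∀ (U : MvPowerSeries (Fin (2 + 1)) k) (V : Fin (2 + 1) → ℕ) (vh : MvPowerSeries (Fin (1 + 1)) k) (e : Fin (1 + 1) → ℕ),
      constantCoeff U ≠ 0 → constantCoeff vh ≠ 0 → e 0 + e 1 ≤ μ →
        WinsIn (m := 2) GermIsNC μ (graphPos U V (vh * ∏ i, X i ^ e i)))
    {U : MvPowerSeries (Fin (2 + 1)) k} {V : Fin (2 + 1) → ℕ} {vh : MvPowerSeries (Fin (1 + 1)) k} {e : Fin (1 + 1) → ℕ}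
    (hU : constantCoeff U ≠ 0) (hvh : constantCoeff vh ≠ 0) (he : e 0 + e 1 ≤ μ + 1) (he0 : 1 ≤ e 0) :
    WinsIn (m := 2) GermIsNC (μ + 1) (graphPos U V (vh * ∏ i, X i ^ e i)) := by
  classical
  obtain ⟨t, ht⟩ : ∃ t, e 0 = t + 1 := ⟨e 0 - 1, by omega⟩
  -- the move: weights `(1, 0, 1)`, identity coordinates
  set w : Fin (2 + 1) → ℕ := fun l => if l = 1 then 0 else 1 with hw
  have hw1 : ∀ l, w l ≤ 1 := fun l => by simp only [hw]; split_ifs <;> omega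
  have hmv : IsCountMove (k := k) (m := 2) X w :=
    ⟨fun i => constantCoeff_X i, isUnit_det_linMat_perm (Equiv.refl _), hw1, ⟨0, by simp [hw]⟩⟩
  refine winsIn_move hmv fun c hc hc0 A G hfac hG => ?_
  have hc1 : c 1 = 0 := hc 1 (by simp [hw])
  have hfac' : subst (CobordantChart.chart w c) (graphPos U V (vh * ∏ i, X i ^ e i)) = X 0 ^ A * G := by
    rw [← hfac, subst_self]; rfl
  have hch := CobordantChart.hasSubst_chart w c hc
  -- plane data of the chart
  set w₁ : Fin (1 + 1) → ℕ := fun i => if i = 1 then 0 else 1 with hw₁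
  set c₁ : Fin (1 + 1) → k := fun i => c (bL h102 i) with hc₁def
  have hbLw : ∀ i, w (bL h102 i) = w₁ i := by
    intro i
    simp only [hw, hw₁]
    by_cases hi : i = 1
    · rw [if_pos hi, if_pos (by rw [hi, bL_one])]
    · rw [if_neg hi, if_neg (fun h' => hi ((bL h102).injective (by rw [h', bL_one])))]
  have hc₁ : ∀ i, w₁ i = 0 → c₁ i = 0 := fun i hi => hc _ (by rw [hbLw]; exact hi)
  have hc₁0 : c₁ 0 = c 0 := by simp only [hc₁def, bL_zero]
  have hc₁1 : c₁ 1 = 0 := by simp only [hc₁def, bL_one]; exact hc1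
  have hch₁ := CobordantChart.hasSubst_chart w₁ c₁ hc₁
  -- the three transforms
  have hvh' : constantCoeff (subst (CobordantChart.chart w₁ c₁) vh) ≠ 0 := by
    rwa [TupleMonomialPhase.constantCoeff_subst_chart w₁ c₁ hc₁]
  have hU' : constantCoeff (subst (CobordantChart.chart w c) U) ≠ 0 := by
    rwa [TupleMonomialPhase.constantCoeff_subst_chart w c hc]
  set brH : MvPowerSeries (Fin (1 + 1 + 1)) k := subst (CobordantChart.chart w₁ c₁) vh * ∏ i, (C (c₁ i) + X i.succ) ^ e i with hbrH
  set BR : MvPowerSeries (Fin (2 + 1 + 1)) k := subst (CobordantChart.chart w c) U * ∏ l, (C (c l) + X l.succ) ^ V l with hBR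
  have hsumV : ∑ l, w l * V l = V 0 + V 2 := by
    rw [Fin.sum_univ_three]
    simp [hw]
  have hE : subst (CobordantChart.chart w c) (U * ∏ l, X l ^ V l) = X 0 ^ (V 0 + V 2) * BR := by
    rw [TupleMonomialPhase.subst_chart_unitMonomial w c hc, hsumV]
  have hH : subst (CobordantChart.chart w c) (rename (bL h102) (vh * ∏ i, X i ^ e i)) =
      X 0 ^ (t + 1) * rename (bL (succ_hM h102)) brH := by
    have hsume : ∑ i, w₁ i * e i = t + 1 := by
      rw [Fin.sum_univ_two]
      simp [hw₁, ht]
    rw [subst_chart_rename_bL h102 hc hbLw (fun i => rfl), TupleMonomialPhase.subst_chart_unitMonomial w₁ c₁ hc₁, hsume, map_mul,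
      map_pow, rename_bL_X_zero h102]
  have hX2 : subst (CobordantChart.chart w c) (X 2 : MvPowerSeries (Fin (2 + 1)) k) = X 0 * (C (c 2) + X (Fin.succ 2)) := by
    rw [subst_X hch, CobordantChart.chart_apply]
    simp [hw]
  -- the transform and its saturation shift
  set Lf : MvPowerSeries (Fin (2 + 1 + 1)) k := (C (c 2) + X (Fin.succ 2)) + X 0 ^ t * rename (bL (succ_hM h102)) brH with hLf
  have hT : subst (CobordantChart.chart w c) (graphPos U V (vh * ∏ i, X i ^ e i)) = X 0 ^ (V 0 + V 2 + 1) * (BR * Lf) := by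
    unfold graphPos
    rw [← coe_substAlgHom hch, map_mul, map_add, coe_substAlgHom hch, hE, hH, hX2, hLf]
    ring
  obtain ⟨j, hj⟩ := exists_eq_X_pow_mul_of_eq (hT.symm.trans hfac') hG
  -- `brH` has no constant term (its `x_0`-factor vanishes at the point when `c_0 = 0`) — used at the points with `c_0 = 0`
  have hbrH0 : c 0 = 0 → constantCoeff brH = 0 := by
    intro h0
    rw [hbrH, map_mul, map_prod]
    refine mul_eq_zero_of_right _ (Finset.prod_eq_zero (Finset.mem_univ (0 : Fin (1 + 1))) ?_)
    rw [map_pow, map_add, constantCoeff_C, constantCoeff_X, add_zero, hc₁0, h0, ht, zero_pow (Nat.succ_ne_zero t)]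
  by_cases hc2 : c 2 = 0
  · -- AN EXCEPTIONAL POINT ON THE OLD AXIS `c = (c_0 : 0 : 0)`: the successor is a graph position with `(e_0 - 1, e_1)`
    have hc0 : c 0 ≠ 0 := by
      intro h0
      apply hc0
      funext l
      fin_cases l
      · exact h0
      · exact hc1
      · exact hc2
    have hc₁0' : c₁ 0 ≠ 0 := by rwa [hc₁0]
    refine ⟨0, hc0, ?_⟩
    obtain ⟨u', hu', hsl⟩ := TupleMonomialPhase.slice_bracket 0 hU' c (l := 0) hc0 V
    obtain ⟨uH, huH, hslH⟩ := TupleMonomialPhase.slice_bracket 0 hvh' c₁ (l := 0) hc₁0' e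
    rw [pow_zero, one_mul, ← hBR] at hsl
    rw [pow_zero, one_mul, ← hbrH] at hslH
    set V' : Fin (2 + 1) → ℕ := fun i' => Fin.cases (motive := fun _ => ℕ) 0
      (fun q => if c ((0 : Fin (2 + 1)).succAbove q) = 0 then V ((0 : Fin (2 + 1)).succAbove q) else 0) i' with hV'
    set e' : Fin (1 + 1) → ℕ := fun i' => Fin.cases (motive := fun _ => ℕ) 0
      (fun q => if c₁ ((0 : Fin (1 + 1)).succAbove q) = 0 then e ((0 : Fin (1 + 1)).succAbove q) else 0) i' with he'
    have hsl2 : TupleGame.slice (0 : Fin (2 + 1)) (X (Fin.succ (2 : Fin (2 + 1))) : MvPowerSeries (Fin (2 + 1 + 1)) k) = X 2 := by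
      have h := TupleMonomialPhase.slice_X_succ_succAbove (k := k) (n := 2) 0 1
      simpa using h
    have hslL : TupleGame.slice (0 : Fin (2 + 1)) (rename (bL (succ_hM h102)) brH) = rename (bL h102) (TupleGame.slice 0 brH) := by
      have h := slice_bL_rename_bL h102 (k := k) 0 brH
      rwa [bL_zero] at h
    have hS : X 0 * TupleGame.slice 0 (BR * Lf) =
        graphPos u' (V' + Pi.single 0 1) (uH * ∏ i, X i ^ (e' + Pi.single (0 : Fin (1 + 1)) t : Fin (1 + 1) → ℕ) i) := by
      unfold graphPos
      rw [prod_X_pow_add_single, prod_X_pow_add_single, hLf, hc2, map_zero, zero_add, slice_mul, hsl, slice_add', hsl2,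
        slice_mul, slice_pow, WildTerminal.slice_X_zero, hslL, hslH, mul_left_comm uH (X 0 ^ t), ← X_pow_mul_rename_bL]
      simp only [hV', he', pow_one]
      ring
    have he'sum : (e' + Pi.single (0 : Fin (1 + 1)) t : Fin (1 + 1) → ℕ) 0 + (e' + Pi.single (0 : Fin (1 + 1)) t : Fin (1 + 1) → ℕ) 1 ≤ μ := by
      have h1 : e' 1 ≤ e 1 := by
        simp only [he']
        show Fin.cases (motive := fun _ => ℕ) 0 _ (Fin.succ 0) ≤ e 1
        rw [Fin.cases_succ]
        split_ifs
        · simp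
        · exact Nat.zero_le _
      have h0 : e' 0 = 0 := by simp only [he']; rfl
      simp only [Pi.add_apply, Pi.single_eq_same, Pi.single_eq_of_ne (one_ne_zero : (1 : Fin (1 + 1)) ≠ 0), h0]
      omega
    have hwinS := ih u' (V' + Pi.single 0 1) uH (e' + Pi.single 0 t) hu' huH he'sum
    rw [← hS] at hwinS
    refine winsIn_of_eq_X_pow_mul (j := j) (mul_ne_zero (MvPowerSeries.prime_X' k (0 : Fin (2 + 1))).ne_zero
      (TupleDropAssembly.slice_ne_zero _ w c hc hw1 A G hfac' hG 0 hc0)) ?_ hwinS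
    rw [hj, slice_mul, slice_pow, WildTerminal.slice_X_zero]
    ring
  · -- AN EXCEPTIONAL POINT OFF THE OLD AXIS (`c_2 ≠ 0`): the successor is NC
    -- the bracketed monomial sliced at a live slot `l` is a unit monomial
    by_cases hc0' : c 0 = 0
    · -- slot `x_2`: the bracket `Lf` becomes a unit
      refine ⟨2, hc2, winsIn_done ?_ μ⟩
      obtain ⟨u', hu', hsl⟩ := TupleMonomialPhase.slice_bracket 0 hU' c (l := 2) hc2 V
      rw [pow_zero, one_mul, ← hBR] at hsl
      set V' : Fin (2 + 1) → ℕ := fun i' => Fin.cases (motive := fun _ => ℕ) 0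
        (fun q => if c ((2 : Fin (2 + 1)).succAbove q) = 0 then V ((2 : Fin (2 + 1)).succAbove q) else 0) i' with hV'
      set g₂ := TupleGame.slice (2 : Fin (2 + 1)) Lf with hg₂
      have hg₂u : constantCoeff g₂ ≠ 0 := by
        rw [hg₂, hLf, slice_add', slice_add', slice_mul, slice_pow, WildTerminal.slice_X_zero,
          WildTerminal.slice_X_succ_self, map_add, map_add, map_zero, add_zero, map_mul, TameFourTupleDrop.constantCoeff_slice,
          TameFourTupleDrop.constantCoeff_slice, constantCoeff_C, constantCoeff_rename, hbrH0 hc0', mul_zero, add_zero]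
        exact hc2
      have hS : X 0 * TupleGame.slice 2 (BR * Lf) = (u' * g₂) * ∏ i, X i ^ (V' + Pi.single (0 : Fin (2 + 1)) 1 : Fin (2 + 1) → ℕ) i := by
        rw [prod_X_pow_add_single, slice_mul, hsl, ← hg₂, pow_one]
        simp only [hV']
        ring
      have hnc : GermIsNC (X 0 * TupleGame.slice 2 (BR * Lf)) := by
        rw [hS]
        exact germIsNC_unitMonomial (by rw [map_mul]; exact mul_ne_zero hu' hg₂u) _
      have hT0 : X 0 * TupleGame.slice 2 G ≠ 0 := mul_ne_zero (MvPowerSeries.prime_X' k (0 : Fin (2 + 1))).ne_zero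
        (TupleDropAssembly.slice_ne_zero _ w c hc hw1 A G hfac' hG 2 hc2)
      have hST : X 0 * TupleGame.slice 2 (BR * Lf) = X 0 ^ j * (X 0 * TupleGame.slice 2 G) := by
        rw [hj, slice_mul, slice_pow, WildTerminal.slice_X_zero]
        ring
      exact germIsNC_of_dvd_pow 0 _ _ (by rw [hST]; exact mul_ne_zero (pow_ne_zero _ (MvPowerSeries.prime_X' k (0 : Fin (2 + 1))).ne_zero) hT0)
        hnc ⟨X 0 ^ j, by rw [zero_add, pow_one, hST, mul_comm]⟩
    · -- slot `x_0`: the bracket `Lf` becomes a unit or a smooth graph over the unflagged letter `x_2`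
      refine ⟨0, hc0', winsIn_done ?_ μ⟩
      obtain ⟨u', hu', hsl⟩ := TupleMonomialPhase.slice_bracket 0 hU' c (l := 0) hc0' V
      rw [pow_zero, one_mul, ← hBR] at hsl
      set V' : Fin (2 + 1) → ℕ := fun i' => Fin.cases (motive := fun _ => ℕ) 0
        (fun q => if c ((0 : Fin (2 + 1)).succAbove q) = 0 then V ((0 : Fin (2 + 1)).succAbove q) else 0) i' with hV'
      have hV'2 : (V' + Pi.single (0 : Fin (2 + 1)) 1 : Fin (2 + 1) → ℕ) 2 = 0 := by
        rw [Pi.add_apply, Pi.single_eq_of_ne (by decide : (2 : Fin (2 + 1)) ≠ 0), add_zero, hV']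
        show Fin.cases (motive := fun _ => ℕ) 0 _ (Fin.succ 1) = 0
        rw [Fin.cases_succ]
        simp [hc2]
      have hsl2 : TupleGame.slice (0 : Fin (2 + 1)) (X (Fin.succ (2 : Fin (2 + 1))) : MvPowerSeries (Fin (2 + 1 + 1)) k) = X 2 := by
        have h := TupleMonomialPhase.slice_X_succ_succAbove (k := k) (n := 2) 0 1
        simpa using h
      have hslL : TupleGame.slice (0 : Fin (2 + 1)) (rename (bL (succ_hM h102)) brH) = rename (bL h102) (TupleGame.slice 0 brH) := by
        have h := slice_bL_rename_bL h102 (k := k) 0 brH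
        rwa [bL_zero] at h
      set g₀ : MvPowerSeries (Fin (2 + 1)) k := C (c 2) + X 2 + rename (bL h102) (X 0 ^ t * TupleGame.slice 0 brH) with hg₀
      have hLf0 : TupleGame.slice (0 : Fin (2 + 1)) Lf = g₀ := by
        rw [hLf, slice_add', slice_add', TupleMonomialPhase.slice_C, hsl2, slice_mul, slice_pow,
          WildTerminal.slice_X_zero, hslL, X_pow_mul_rename_bL]
      have hS : X 0 * TupleGame.slice 0 (BR * Lf) = u' * g₀ ^ 1 * ∏ i, X i ^ (V' + Pi.single (0 : Fin (2 + 1)) 1 : Fin (2 + 1) → ℕ) i := by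
        rw [prod_X_pow_add_single, slice_mul, hsl, hLf0, pow_one, pow_one]
        simp only [hV']
        ring
      have hnc : GermIsNC (X 0 * TupleGame.slice 0 (BR * Lf)) := by
        rw [hS]
        by_cases hg : constantCoeff g₀ = 0
        · refine germIsNC_of_smooth_mul_unitMonomial 2 hg ?_ hu' 1 hV'2
          rw [hg₀, map_add, map_add, coeff_C, if_neg (Finsupp.single_ne_zero.mpr one_ne_zero), zero_add, coeff_X, if_pos rfl,
            coeff_single_rename_of_not_mem (bL h102) _ two_not_mem_range_bL, add_zero]
          exact one_ne_zero
        · rw [pow_one]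
          exact germIsNC_unitMonomial (by rw [map_mul]; exact mul_ne_zero hu' hg) _
      have hT0 : X 0 * TupleGame.slice 0 G ≠ 0 := mul_ne_zero (MvPowerSeries.prime_X' k (0 : Fin (2 + 1))).ne_zero
        (TupleDropAssembly.slice_ne_zero _ w c hc hw1 A G hfac' hG 0 hc0')
      have hST : X 0 * TupleGame.slice 0 (BR * Lf) = X 0 ^ j * (X 0 * TupleGame.slice 0 G) := by
        rw [hj, slice_mul, slice_pow, WildTerminal.slice_X_zero]
        ring
      exact germIsNC_of_dvd_pow 0 _ _ (by rw [hST]; exact mul_ne_zero (pow_ne_zero _ (MvPowerSeries.prime_X' k (0 : Fin (2 + 1))).ne_zero) hT0)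
        hnc ⟨X 0 ^ j, by rw [zero_add, pow_one, hST, mul_comm]⟩

/-- SWAPPING THE PLANE LETTERS `x_0 ↔ x_1` maps graph positions to graph positions. -/
theorem rename_swap_graphPos (U : MvPowerSeries (Fin (2 + 1)) k) (V : Fin (2 + 1) → ℕ) (vh : MvPowerSeries (Fin (1 + 1)) k)
    (e : Fin (1 + 1) → ℕ) :
    rename (Equiv.swap (0 : Fin (2 + 1)) 1) (graphPos U V (vh * ∏ i, X i ^ e i)) =
      graphPos (rename (Equiv.swap (0 : Fin (2 + 1)) 1) U) (fun l => V (Equiv.swap (0 : Fin (2 + 1)) 1 l))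
        (rename (Equiv.swap (0 : Fin (1 + 1)) 1) vh * ∏ i, X i ^ e (Equiv.swap (0 : Fin (1 + 1)) 1 i)) := by
  obtain ⟨π, hπ⟩ : ∃ π : Equiv.Perm (Fin (2 + 1)), π = Equiv.swap 0 1 := ⟨_, rfl⟩
  obtain ⟨τ, hτ⟩ : ∃ τ : Equiv.Perm (Fin (1 + 1)), τ = Equiv.swap 0 1 := ⟨_, rfl⟩
  rw [← hπ, ← hτ]
  have hcomp : ∀ i : Fin (1 + 1), π (bL h102 i) = bL h102 (τ i) := by rw [hπ, hτ]; decide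
  have hπ2 : π 2 = 2 := by rw [hπ]; decide
  have hππ : ∀ l, π (π l) = l := fun l => by rw [hπ]; exact Equiv.swap_apply_self _ _ _
  have hττ : ∀ i, τ (τ i) = i := fun i => by rw [hτ]; exact Equiv.swap_apply_self _ _ _
  have hLL : ∀ Z : MvPowerSeries (Fin (1 + 1)) k, rename π (rename (bL h102) Z) = rename (bL h102) (rename τ Z) := by
    intro Z
    rw [rename_eq_subst (⇑π) (rename (bL h102) Z), subst_rename_eq _ (HasSubst.X_comp _) Z,
      rename_eq_subst (⇑(bL h102)) (rename τ Z), subst_rename_eq _ (HasSubst.X_comp _) Z]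
    congr 1
    funext i
    simp only [Function.comp_apply, hcomp]
  have hmon3 : rename π (∏ l, (X l : MvPowerSeries (Fin (2 + 1)) k) ^ V l) = ∏ l, X l ^ V (π l) := by
    rw [map_prod]
    simp only [map_pow, rename_X]
    calc (∏ l, (X (π l) : MvPowerSeries (Fin (2 + 1)) k) ^ V l)
        = ∏ l, (fun l' => (X l' : MvPowerSeries (Fin (2 + 1)) k) ^ V (π l')) (π l) :=
          Finset.prod_congr rfl fun l _ => by simp only [hππ]
      _ = ∏ l, X l ^ V (π l) := Equiv.prod_comp π (fun l' => (X l' : MvPowerSeries (Fin (2 + 1)) k) ^ V (π l'))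
  have hmon2 : rename τ (∏ i, (X i : MvPowerSeries (Fin (1 + 1)) k) ^ e i) = ∏ i, X i ^ e (τ i) := by
    rw [map_prod]
    simp only [map_pow, rename_X]
    calc (∏ i, (X (τ i) : MvPowerSeries (Fin (1 + 1)) k) ^ e i)
        = ∏ i, (fun i' => (X i' : MvPowerSeries (Fin (1 + 1)) k) ^ e (τ i')) (τ i) :=
          Finset.prod_congr rfl fun i _ => by simp only [hττ]
      _ = ∏ i, X i ^ e (τ i) := Equiv.prod_comp τ (fun i' => (X i' : MvPowerSeries (Fin (1 + 1)) k) ^ e (τ i'))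
  unfold graphPos
  rw [map_mul, map_mul, map_add, rename_X, hπ2, hmon3, hLL, map_mul, hmon2]

/-- **PHASE 2.**  A graph position with monomial data `h = vh · x_0^{e_0} x_1^{e_1}` is won within `e_0 + e_1` rounds. -/
theorem winsIn_graphPos : ∀ (μ : ℕ) (U : MvPowerSeries (Fin (2 + 1)) k) (V : Fin (2 + 1) → ℕ) (vh : MvPowerSeries (Fin (1 + 1)) k)
    (e : Fin (1 + 1) → ℕ), constantCoeff U ≠ 0 → constantCoeff vh ≠ 0 → e 0 + e 1 ≤ μ →
      WinsIn (m := 2) GermIsNC μ (graphPos U V (vh * ∏ i, X i ^ e i)) := by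
  intro μ
  induction μ with
  | zero =>
    intro U V vh e hU hvh he
    have he0 : e 0 = 0 := by omega
    have he1 : e 1 = 0 := by omega
    have h1 : (∏ i, (X i : MvPowerSeries (Fin (1 + 1)) k) ^ e i) = 1 := by
      rw [Fin.prod_univ_two, he0, he1, pow_zero, pow_zero, one_mul]
    rw [h1, mul_one]
    exact winsIn_done (germIsNC_graphPos_unit hU V hvh) 0
  | succ μ ih =>
    intro U V vh e hU hvh he
    by_cases hle : e 0 + e 1 ≤ μ
    · exact WinsIn.mono (Nat.le_succ μ) (ih U V vh e hU hvh hle)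
    by_cases he0 : 1 ≤ e 0
    · exact winsIn_graphPos_step μ ih hU hvh he he0
    · -- `e_0 = 0 < e_1`: swap the plane letters first (a permutation of the variables is a legal coordinate change)
      have he1 : 1 ≤ e 1 := by omega
      have hsw := winsIn_graphPos_step μ ih (U := rename (Equiv.swap (0 : Fin (2 + 1)) 1) U)
        (V := fun l => V (Equiv.swap (0 : Fin (2 + 1)) 1 l)) (vh := rename (Equiv.swap (0 : Fin (1 + 1)) 1) vh)
        (e := fun i => e (Equiv.swap (0 : Fin (1 + 1)) 1 i)) (by rw [constantCoeff_rename]; exact hU)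
        (by rw [constantCoeff_rename]; exact hvh) (by rw [Equiv.swap_apply_left, Equiv.swap_apply_right]; omega)
        (by rw [Equiv.swap_apply_left]; exact he1)
      rw [← rename_swap_graphPos, rename_eq_subst] at hsw
      exact winsIn_germIsNC_of_subst (fun l => constantCoeff_X _) (isUnit_det_linMat_perm (Equiv.swap (0 : Fin (2 + 1)) 1)) _ _ hsw

end Phase2

end NCTransport

end Summit.ResolutionOfSingularities.ResolutionOfSingularities.Theorems
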